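import Literature.NumberTheory.Transcendental.NesterenkoElimination
import Mathlib.RingTheory.Localization.Away.Basic
import HarnessLib

/-!
# The `U`-eliminant ideal `Ī(r)`: Philippon's Lemma 1.2 and Proposition 1.3 (ii), (iv) — proved

Topic `Literature/NumberTheory/Transcendental`. For the objects of `NesterenkoElimination.lean`
(`Ī(r) = elimIdeal I r`, `(I, L₁, …, L_r) = extIdeal I r`, Nesterenko–Philippon (eds.), LNM 1752,
Ch. 3 Def. 4.3; this is Philippon's `𝔈_d(I)` of *Critères pour l'indépendance algébrique*, Publ.
Math. IHÉS 64 (1986) §1, Déf. 1.1, in the case `d = (1, …, 1)`, `R = K = ℚ`), this file PROVES the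
first structural results of Philippon's §1, which are the algebraic backbone of LNM 1752 Ch. 3
Prop. 4.4 (`NesterenkoEliminationFacts.lean`):

* **Lemma 1.2** (localisation description). For each `j` let `B_j = (ℚ[x̲]/I)[1/x̄_j]` (`Bloc I j`)
  and `Θ_j : ℚ[U, x̲] → B_j[U]` (`theta I r j`) the substitution `x_k ↦ x̄_k`, `u_{ik} ↦ u_{ik}`
  (`k ≠ j`), `u_{ij} ↦ -(1/x̄_j) ∑_{k ≠ j} x̄_k u_{ik}` (solving `Lᵢ = 0` for `u_{ij}`; this is
  Philippon's `s_i ∘ b`). Then `Θ_j(P) = 0 ⇔ x_j^M P ∈ (I, L₁, …, L_r)` for some `M`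
  (`theta_eq_zero_iff`), hence `G ∈ Ī(r) ⇔ Θ_j(G) = 0` for all `j` (`mem_elimIdeal_iff_theta`).
  Proof: `Θ_j` kills `(I, L)` and `x̄_j` is a unit in `B_j` (easy half); conversely `Θ_j` factors
  through `C[1/x̄_j]`, `C = ℚ[U, x̲]/(I, L)`, by a map `ψ` which has a left inverse `χ`
  (`u_{ik} ↦ ū_{ik}`; `χ ∘ ψ = id` because `ū_{ij} = -(1/x̄_j) ∑_{k≠j} x̄_k ū_{ik}` in `C[1/x̄_j]`),
  so `Θ_j(P) = 0` forces `P ↦ 0` in `C[1/x̄_j]`, i.e. `x̄_j^M P = 0` in `C`.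
* **Prop. 1.3 (iv)**: `(⋂_{Q ∈ t} Q)‾(r) = ⋂_{Q ∈ t} Q̄(r)` (`elimIdeal_finset_inf`,
  `elimIdeal_eq_iInf_of_isMinimalPrimaryDecomposition`), by naturality of `Θ_j` in `I`
  (`map_piB_comp_theta`) and the fact that an element of `B_j(⋂ Q)` vanishing in every `B_j(Q)`
  vanishes (`eq_zero_of_forall_piB_eq_zero`).
* **Prop. 1.3 (ii)** and the **generic-point description**: for a prime `𝔭` and `x_{j₀} ∉ 𝔭`, with
  `Ω = Frac(ℚ[x̲]/𝔭)` and generic point `ξ = (x̄_k)_k`, let `Φ_{j₀} : ℚ[U] → Ω[U]` (`Phi 𝔭 r j₀`)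
  substitute `u_{ij₀} ↦ -(1/ξ_{j₀}) ∑_{k ≠ j₀} ξ_k u_{ik}` — "`G` evaluated on the generic `r`-tuple
  of hyperplanes through `ξ`" (Hodge–Pedoe II, Ch. X §6, eq. (1)). Then
  `𝔭̄(r) = ker Φ_{j₀}` (`mem_elimIdeal_iff_Phi`, `elimIdeal_eq_ker_Phi`), independently of the
  choice of `j₀` (`Phi_eq_zero_iff_of_notMem`, via `τ_j ∘ τ_{j'} = τ_j`, `tau_comp_tau`), and in
  particular `𝔭̄(r)` is PRIME whenever `𝔭 ⊉ (x₀, …, x_m)` (`isPrime_elimIdeal`).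

Deliberately NOT here: Prop. 1.3 (iii) (primary ideals), Prop. 1.4 (zeros), Prop. 1.5
(principality), which are separate results.

## References

* [Philippon1986Criteres] P. Philippon, *Critères pour l'indépendance algébrique*, Publ. Math.
  IHÉS 64 (1986) 5–52, §1: Déf. 1.1 (p. 9), Lemme 1.2, Prop. 1.3 (pp. 10–11).
* [NesterenkoPhilippon2001] LNM 1752 (2001), Ch. 3 (Yu. V. Nesterenko) §4, Def. 4.3, Prop. 4.4
  (p. 38).
* [HodgePedoe1994] W. V. D. Hodge, D. Pedoe, *Methods of Algebraic Geometry* II (CUP 1952, repr.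
  1994), Ch. X §6 (the Cayley form via the generic point).
-/

noncomputable section

open MvPolynomial

namespace Literature.NumberTheory.Transcendental

namespace Nesterenko

variable {m : ℕ}

section Theta

variable (I : Ideal (Rx m)) (r : ℕ) (j : Fin (m + 1))

/-- `x̄_k`, the class of `x_k` in `ℚ[x̲]/I`. [folklore] -/
abbrev xq (k : Fin (m + 1)) : Rx m ⧸ I := Ideal.Quotient.mk I (X k)

/-- `B_j = (ℚ[x̲]/I)[1/x̄_j]`. [cite: Philippon1986Criteres, Lemme 1.2 (p. 10)] -/
abbrev Bloc : Type := Localization.Away (xq I j)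

/-- `x̄_k / 1 ∈ B_j`. [folklore] -/
abbrev xB (k : Fin (m + 1)) : Bloc I j := algebraMap (Rx m ⧸ I) (Bloc I j) (xq I k)

/-- `ℚ → B_j`. [folklore] -/
def cB : ℚ →+* Bloc I j := (algebraMap (Rx m ⧸ I) (Bloc I j)).comp ((Ideal.Quotient.mk I).comp C)

/-- The value substituted for `u_{ik}` in `B_j[U]`: `u_{ik}` itself for `k ≠ j`, and
`-(1/x̄_j) ∑_{k ≠ j} x̄_k u_{ik}` for `k = j` (solving `Lᵢ = 0` for `u_{ij}`).
[cite: Philippon1986Criteres, Lemme 1.2 (p. 10)] -/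
def thetaU (ik : Fin r × Fin (m + 1)) : MvPolynomial (Fin r × Fin (m + 1)) (Bloc I j) :=
  if ik.2 = j then
    -(C (IsLocalization.Away.invSelf (xq I j)) *
        ∑ k ∈ Finset.univ.erase j, C (xB I j k) * X (ik.1, k))
  else X ik

/-- **Philippon's substitution** `Θ_j : ℚ[U, x̲] → B_j[U]`, `x_k ↦ x̄_k`, `u_{ik} ↦ u_{ik}` (`k ≠ j`),
`u_{ij} ↦ -(1/x̄_j) ∑_{k ≠ j} x̄_k u_{ik}`. [cite: Philippon1986Criteres, Lemme 1.2 (p. 10)] -/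
def theta : RUX r m →+* MvPolynomial (Fin r × Fin (m + 1)) (Bloc I j) :=
  eval₂Hom (C.comp (cB I j)) (Sum.elim (thetaU I r j) fun k => C (xB I j k))

/-- `Θ_j(x_k) = x̄_k`. [folklore] -/
@[simp] theorem theta_X_inr (k : Fin (m + 1)) : theta I r j (X (Sum.inr k)) = C (xB I j k) := by
  simp [theta]

/-- `Θ_j(u_{ik})` is the substituted value `thetaU`. [folklore] -/
@[simp] theorem theta_X_inl (ik : Fin r × Fin (m + 1)) : theta I r j (X (Sum.inl ik)) = thetaU I r j ik := by
  simp [theta]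

/-- `Θ_j` on constants. [folklore] -/
@[simp] theorem theta_C (c : ℚ) : theta I r j (C c) = C (cB I j c) := by
  simp [theta]

/-- `Θ_j(u_{ik}) = u_{ik}` for `k ≠ j`. [folklore] -/
theorem thetaU_of_ne {ik : Fin r × Fin (m + 1)} (h : ik.2 ≠ j) : thetaU I r j ik = X ik := by
  simp [thetaU, h]

/-- `Θ_j(u_{ij}) = -(1/x̄_j) ∑_{k ≠ j} x̄_k u_{ik}`. [folklore] -/
theorem thetaU_self (i : Fin r) :
    thetaU I r j (i, j) = -(C (IsLocalization.Away.invSelf (xq I j)) *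
        ∑ k ∈ Finset.univ.erase j, C (xB I j k) * X (i, k)) := by
  simp [thetaU]

/-- `Θ_j` on `ℚ[x̲] ⊆ ℚ[U, x̲]` is reduction mod `I` followed by `B_j ⊆ B_j[U]`. [folklore] -/
theorem theta_rename_inr (p : Rx m) :
    theta I r j (rename Sum.inr p) = C (algebraMap (Rx m ⧸ I) (Bloc I j) (Ideal.Quotient.mk I p)) := by
  have : (theta I r j).comp (rename (Sum.inr : Fin (m + 1) → _)).toRingHom =
      C.comp ((algebraMap (Rx m ⧸ I) (Bloc I j)).comp (Ideal.Quotient.mk I)) := by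
    apply MvPolynomial.ringHom_ext
    · intro c
      simp [cB]
    · intro k
      simp
  exact RingHom.congr_fun this p

/-- `x̄_j` is a unit in `B_j[U]`. [folklore] -/
theorem isUnit_C_xB : IsUnit (C (xB I j j) : MvPolynomial (Fin r × Fin (m + 1)) (Bloc I j)) :=
  (IsLocalization.Away.algebraMap_isUnit (xq I j)).map C

/-- `x̄_j · (1/x̄_j) = 1` in `B_j[U]`. [folklore] -/
theorem C_xB_mul_C_invSelf :
    (C (xB I j j) : MvPolynomial (Fin r × Fin (m + 1)) (Bloc I j)) *
      C (IsLocalization.Away.invSelf (xq I j)) = 1 := by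
  rw [← map_mul, IsLocalization.Away.mul_invSelf, map_one]

/-- `Θ_j(Lᵢ) = 0`. [cite: Philippon1986Criteres, Lemme 1.2 (p. 10)] -/
theorem theta_linForm (i : Fin r) : theta I r j (linForm r m i) = 0 := by
  simp only [linForm, map_sum, map_mul, theta_X_inl, theta_X_inr]
  rw [← Finset.add_sum_erase _ _ (Finset.mem_univ j), thetaU_self]
  have hrest : ∑ k ∈ Finset.univ.erase j, thetaU I r j (i, k) * C (xB I j k) =
      ∑ k ∈ Finset.univ.erase j, C (xB I j k) * X (i, k) := by
    refine Finset.sum_congr rfl fun k hk => ?_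
    rw [thetaU_of_ne I r j (by simpa using Finset.ne_of_mem_erase hk), mul_comm]
  rw [hrest]
  set S := ∑ k ∈ Finset.univ.erase j, C (xB I j k) * X (i, k)
  have h1 := C_xB_mul_C_invSelf I j (r := r)
  linear_combination (-S) * h1

/-- `Θ_j` kills `(I, L₁, …, L_r)`. [cite: Philippon1986Criteres, Lemme 1.2 (p. 10)] -/
theorem extIdeal_le_ker_theta : extIdeal I r ≤ RingHom.ker (theta I r j) := by
  refine sup_le ?_ ?_
  · rw [Ideal.map_le_iff_le_comap]
    intro p hp
    rw [Ideal.mem_comap, RingHom.mem_ker, theta_rename_inr, Ideal.Quotient.eq_zero_iff_mem.2 hp,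
      map_zero, map_zero]
  · rw [Ideal.span_le]
    rintro _ ⟨i, rfl⟩
    exact theta_linForm I r j i

/-- `Θ_j` vanishes on `(I, L₁, …, L_r)`. [folklore] -/
theorem theta_eq_zero_of_mem_extIdeal {P : RUX r m} (hP : P ∈ extIdeal I r) : theta I r j P = 0 :=
  extIdeal_le_ker_theta I r j hP

/-- Easy half of Lemma 1.2: `x_j^M P ∈ (I, L) ⇒ Θ_j(P) = 0`. [cite: Philippon1986Criteres, Lemme 1.2 (p. 10)] -/
theorem theta_eq_zero_of_X_pow_mul_mem {P : RUX r m} {M : ℕ}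
    (hP : X (Sum.inr j) ^ M * P ∈ extIdeal I r) : theta I r j P = 0 := by
  have h := theta_eq_zero_of_mem_extIdeal I r j hP
  rw [map_mul, map_pow, theta_X_inr] at h
  exact ((isUnit_C_xB I r j).pow M).mul_right_eq_zero.1 h

end Theta

section Lift

variable (I : Ideal (Rx m)) (r : ℕ) (j : Fin (m + 1))

/-- `C = ℚ[U, x̲]/(I, L₁, …, L_r)`. [folklore] -/
abbrev Cq : Type := RUX r m ⧸ extIdeal I r

/-- The quotient map `ℚ[U, x̲] → C`. [folklore] -/
abbrev mkE : RUX r m →+* Cq I r := Ideal.Quotient.mk (extIdeal I r)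

/-- The class of `x_j` in `C`. [folklore] -/
abbrev xE : Cq I r := mkE I r (X (Sum.inr j))

/-- `C[1/x̄_j]`. [folklore] -/
abbrev Cloc : Type := Localization.Away (xE I r j)

/-- `C → C[1/x̄_j]`. [folklore] -/
abbrev aC : Cq I r →+* Cloc I r j := algebraMap (Cq I r) (Cloc I r j)

/-- `φ : C → B_j[U]` induced by `Θ_j`. [folklore] -/
def phi : Cq I r →+* MvPolynomial (Fin r × Fin (m + 1)) (Bloc I j) :=
  Ideal.Quotient.lift (extIdeal I r) (theta I r j) fun _ hP => theta_eq_zero_of_mem_extIdeal I r j hP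

/-- `φ ∘ (ℚ[U,x̲] → C) = Θ_j`. [folklore] -/
theorem phi_mkE (P : RUX r m) : phi I r j (mkE I r P) = theta I r j P :=
  Ideal.Quotient.lift_mk _ _ _

/-- `φ(x̄_j)` is a unit. [folklore] -/
theorem isUnit_phi_xE : IsUnit (phi I r j (xE I r j)) := by
  rw [phi_mkE, theta_X_inr]
  exact isUnit_C_xB I r j

/-- `ψ : C[1/x̄_j] → B_j[U]` induced by `φ`. [folklore] -/
def psi : Cloc I r j →+* MvPolynomial (Fin r × Fin (m + 1)) (Bloc I j) :=
  IsLocalization.Away.lift (xE I r j) (isUnit_phi_xE I r j)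

/-- `ψ` extends `φ`. [folklore] -/
theorem psi_aC (c : Cq I r) : psi I r j (aC I r j c) = phi I r j c :=
  IsLocalization.Away.lift_eq _ _ _

/-- `ρ₀ : ℚ[x̲]/I → C[1/x̄_j]`. [folklore] -/
def rhoB0 : (Rx m ⧸ I) →+* Cloc I r j :=
  Ideal.Quotient.lift I ((aC I r j).comp ((mkE I r).comp (rename Sum.inr).toRingHom)) fun p hp => by
    have hmem : rename Sum.inr p ∈ extIdeal I r :=
      Ideal.mem_sup_left (Ideal.mem_map_of_mem (rename Sum.inr) hp)
    have h0 : mkE I r (rename Sum.inr p) = 0 := Ideal.Quotient.eq_zero_iff_mem.2 hmem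
    simp only [RingHom.comp_apply, AlgHom.toRingHom_eq_coe, RingHom.coe_coe]
    rw [h0, map_zero]

/-- `ρ₀` on classes of polynomials. [folklore] -/
theorem rhoB0_mk (p : Rx m) : rhoB0 I r j (Ideal.Quotient.mk I p) = aC I r j (mkE I r (rename Sum.inr p)) :=
  Ideal.Quotient.lift_mk _ _ _

/-- `ρ₀(x̄_j)` is a unit. [folklore] -/
theorem isUnit_rhoB0_xq : IsUnit (rhoB0 I r j (xq I j)) := by
  rw [rhoB0_mk, rename_X]
  exact IsLocalization.Away.algebraMap_isUnit (xE I r j)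

/-- `ρ : B_j → C[1/x̄_j]` induced by `ρ₀`. [folklore] -/
def rhoB : Bloc I j →+* Cloc I r j :=
  IsLocalization.Away.lift (xq I j) (isUnit_rhoB0_xq I r j)

/-- `ρ` extends `ρ₀`. [folklore] -/
theorem rhoB_algebraMap (a : Rx m ⧸ I) : rhoB I r j (algebraMap _ (Bloc I j) a) = rhoB0 I r j a :=
  IsLocalization.Away.lift_eq _ _ _

/-- `ρ(x̄_k) = x̄_k`. [folklore] -/
theorem rhoB_xB (k : Fin (m + 1)) : rhoB I r j (xB I j k) = aC I r j (mkE I r (X (Sum.inr k))) := by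
  rw [rhoB_algebraMap, rhoB0_mk, rename_X]

/-- `ρ(1/x̄_j) · x̄_j = 1`. [folklore] -/
theorem rhoB_invSelf_mul : rhoB I r j (IsLocalization.Away.invSelf (xq I j)) * aC I r j (xE I r j) = 1 := by
  rw [← rhoB_xB, ← map_mul, mul_comm, IsLocalization.Away.mul_invSelf, map_one]

/-- `χ : B_j[U] → C[1/x̄_j]`, `u_{ik} ↦ ū_{ik}` (a left inverse of `ψ`). [folklore] -/
def chi : MvPolynomial (Fin r × Fin (m + 1)) (Bloc I j) →+* Cloc I r j :=
  eval₂Hom (rhoB I r j) fun ik => aC I r j (mkE I r (X (Sum.inl ik)))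

/-- In `C` (hence in `C[1/x̄_j]`), `Lᵢ = 0`: `ū_{ij} x̄_j + ∑_{k≠j} ū_{ik} x̄_k = 0`. [folklore] -/
theorem aC_linForm_rel (i : Fin r) :
    aC I r j (mkE I r (X (Sum.inl (i, j)))) * aC I r j (xE I r j) +
      ∑ k ∈ Finset.univ.erase j,
        aC I r j (mkE I r (X (Sum.inr k))) * aC I r j (mkE I r (X (Sum.inl (i, k)))) = 0 := by
  have hmem : linForm r m i ∈ extIdeal I r :=
    Ideal.mem_sup_right (Ideal.subset_span (Set.mem_range_self i))
  have h0 : aC I r j (mkE I r (linForm r m i)) = 0 := by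
    rw [Ideal.Quotient.eq_zero_iff_mem.2 hmem, map_zero]
  rw [linForm, map_sum, map_sum, ← Finset.add_sum_erase _ _ (Finset.mem_univ j)] at h0
  simp only [map_mul] at h0
  rw [← h0]
  congr 1
  exact Finset.sum_congr rfl fun k _ => mul_comm _ _

/-- `χ ∘ ψ ∘ (C → C[1/x̄_j]) ∘ (ℚ[U,x̲] → C) = (C → C[1/x̄_j]) ∘ (ℚ[U,x̲] → C)`. [folklore] -/
theorem chi_psi_aC_mkE :
    ((chi I r j).comp (psi I r j)).comp ((aC I r j).comp (mkE I r)) = (aC I r j).comp (mkE I r) := by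
  apply MvPolynomial.ringHom_ext
  · intro c
    simp only [RingHom.comp_apply, psi_aC, phi_mkE, theta_C, chi, eval₂Hom_C, cB, rhoB_algebraMap,
      rhoB0_mk, rename_C]
  · rintro (⟨i, k⟩ | k)
    · by_cases hk : k = j
      · subst hk
        simp only [RingHom.comp_apply, psi_aC, phi_mkE, theta_X_inl, thetaU_self, map_neg, map_mul,
          map_sum, chi, eval₂Hom_C, eval₂Hom_X', rhoB_xB]
        have h1 := rhoB_invSelf_mul I r k
        have h2 := aC_linForm_rel I r k i
        set ri := rhoB I r k (IsLocalization.Away.invSelf (xq I k))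
        set S := ∑ x ∈ Finset.univ.erase k,
          aC I r k (mkE I r (X (Sum.inr x))) * aC I r k (mkE I r (X (Sum.inl (i, x))))
        linear_combination (-ri) * h2 + (aC I r k (mkE I r (X (Sum.inl (i, k))))) * h1
      · simp only [RingHom.comp_apply, psi_aC, phi_mkE, theta_X_inl,
          thetaU_of_ne I r j (show (i, k).2 ≠ j from hk), chi, eval₂Hom_X']
    · simp only [RingHom.comp_apply, psi_aC, phi_mkE, theta_X_inr, chi, eval₂Hom_C, rhoB_xB]

/-- `χ ∘ ψ = id`: `ψ` is injective. [folklore] -/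
theorem chi_comp_psi : (chi I r j).comp (psi I r j) = RingHom.id _ := by
  apply IsLocalization.ringHom_ext (Submonoid.powers (xE I r j))
  apply Ideal.Quotient.ringHom_ext
  rw [RingHom.comp_assoc, RingHom.id_comp]
  exact chi_psi_aC_mkE I r j

/-- Hard half of Lemma 1.2: `Θ_j(P) = 0 ⇒ x_j^M P ∈ (I, L)` for some `M`.
[cite: Philippon1986Criteres, Lemme 1.2 (p. 10)] -/
theorem exists_X_pow_mul_mem_of_theta_eq_zero {P : RUX r m} (h : theta I r j P = 0) :
    ∃ M : ℕ, X (Sum.inr j) ^ M * P ∈ extIdeal I r := by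
  have h1 : psi I r j (aC I r j (mkE I r P)) = 0 := by rw [psi_aC, phi_mkE, h]
  have h2 : aC I r j (mkE I r P) = 0 := by
    have := congrArg (chi I r j) h1
    rwa [map_zero, ← RingHom.comp_apply, chi_comp_psi, RingHom.id_apply] at this
  obtain ⟨⟨_, n, rfl⟩, hc⟩ :=
    (IsLocalization.map_eq_zero_iff (Submonoid.powers (xE I r j)) (Cloc I r j) _).1 h2
  refine ⟨n, ?_⟩
  rw [← Ideal.Quotient.eq_zero_iff_mem, map_mul, map_pow]
  exact hc

/-- **Philippon's Lemma 1.2, kernel form**: `Θ_j(P) = 0 ⇔ x_j^M P ∈ (I, L₁, …, L_r)` for some `M`.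
[cite: Philippon1986Criteres, Lemme 1.2 (p. 10)] -/
theorem theta_eq_zero_iff (P : RUX r m) :
    theta I r j P = 0 ↔ ∃ M : ℕ, X (Sum.inr j) ^ M * P ∈ extIdeal I r :=
  ⟨exists_X_pow_mul_mem_of_theta_eq_zero I r j, fun ⟨_, hM⟩ => theta_eq_zero_of_X_pow_mul_mem I r j hM⟩

end Lift

/-- **Philippon's Lemma 1.2** (for `d = (1, …, 1)`, `R = ℚ`): `G ∈ Ī(r)` iff `Θ_j(G) = 0` in
`B_j[U] = (ℚ[x̲]/I)[1/x̄_j][U]` for every `j`. [cite: Philippon1986Criteres, Lemme 1.2 (p. 10)] -/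
theorem mem_elimIdeal_iff_theta (I : Ideal (Rx m)) (r : ℕ) (G : RU r m) :
    G ∈ elimIdeal I r ↔ ∀ j, theta I r j (rename Sum.inl G) = 0 := by
  constructor
  · rintro ⟨M, -, hM⟩ j
    refine theta_eq_zero_of_X_pow_mul_mem I r j (M := M) ?_
    rw [mul_comm]
    exact hM j
  · intro h
    choose M hM using fun j => exists_X_pow_mul_mem_of_theta_eq_zero I r j (h j)
    refine ⟨Finset.univ.sup M + 1, Nat.succ_pos _, fun j => ?_⟩
    have hle : M j ≤ Finset.univ.sup M := Finset.le_sup (f := M) (Finset.mem_univ j)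
    have e : rename Sum.inl G * X (Sum.inr j) ^ (Finset.univ.sup M + 1) =
        X (Sum.inr j) ^ (Finset.univ.sup M + 1 - M j) * (X (Sum.inr j) ^ M j * rename Sum.inl G) := by
      rw [← mul_assoc, ← pow_add, Nat.sub_add_cancel (by omega), mul_comm]
    rw [e]
    exact Ideal.mul_mem_left _ _ (hM j)

/-! ### Functoriality in `I` and Proposition 1.3 (iv): `Ī(r)` of an intersection -/

section Functorial

variable {I Q : Ideal (Rx m)} (h : I ≤ Q) (r : ℕ) (j : Fin (m + 1))

/-- Powers of `x̄_j` map to powers of `x̄_j` under `ℚ[x̲]/I → ℚ[x̲]/Q`. [folklore] -/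
theorem powers_le_comap_factor :
    Submonoid.powers (xq I j) ≤ (Submonoid.powers (xq Q j)).comap (Ideal.Quotient.factor h) := by
  rintro _ ⟨n, rfl⟩
  exact ⟨n, by rw [map_pow, Ideal.Quotient.factor_mk]⟩

/-- The natural map `B_j(I) → B_j(Q)` for `I ⊆ Q`. [folklore] -/
def piB : Bloc I j →+* Bloc Q j :=
  IsLocalization.map (M := Submonoid.powers (xq I j)) (T := Submonoid.powers (xq Q j)) (Bloc Q j)
    (Ideal.Quotient.factor h) (powers_le_comap_factor h j)

/-- `B_j(I) → B_j(Q)` extends `ℚ[x̲]/I → ℚ[x̲]/Q`. [folklore] -/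
theorem piB_algebraMap (a : Rx m ⧸ I) :
    piB h j (algebraMap _ (Bloc I j) a) = algebraMap _ (Bloc Q j) (Ideal.Quotient.factor h a) :=
  IsLocalization.map_eq _ _

/-- `B_j(I) → B_j(Q)` maps `x̄_k` to `x̄_k`. [folklore] -/
theorem piB_xB (k : Fin (m + 1)) : piB h j (xB I j k) = xB Q j k := by
  rw [piB_algebraMap, Ideal.Quotient.factor_mk]

/-- `B_j(I) → B_j(Q)` maps `1/x̄_j` to `1/x̄_j`. [folklore] -/
theorem piB_invSelf :
    piB h j (IsLocalization.Away.invSelf (xq I j)) = IsLocalization.Away.invSelf (xq Q j) := by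
  have hu : IsUnit (xB Q j j) := IsLocalization.Away.algebraMap_isUnit (xq Q j)
  have h1 : piB h j (IsLocalization.Away.invSelf (xq I j)) * xB Q j j = 1 := by
    rw [← piB_xB h j j, ← map_mul, mul_comm, IsLocalization.Away.mul_invSelf, map_one]
  have h2 : IsLocalization.Away.invSelf (xq Q j) * xB Q j j = 1 := by
    rw [mul_comm, IsLocalization.Away.mul_invSelf]
  exact hu.mul_left_inj.1 (h1.trans h2.symm)

/-- Naturality of `Θ_j` in `I`: `Θ_j^Q = (B_j(I) → B_j(Q)) ∘ Θ_j^I`. [folklore] -/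
theorem map_piB_comp_theta : (MvPolynomial.map (piB h j)).comp (theta I r j) = theta Q r j := by
  apply MvPolynomial.ringHom_ext
  · intro c
    simp only [RingHom.comp_apply, theta_C, map_C, cB, piB_algebraMap, Ideal.Quotient.factor_mk]
  · rintro (⟨i, k⟩ | k)
    · by_cases hk : k = j
      · subst hk
        simp only [RingHom.comp_apply, theta_X_inl, thetaU_self, map_neg, map_mul, map_sum, map_C,
          map_X, piB_xB, piB_invSelf]
      · simp only [RingHom.comp_apply, theta_X_inl, thetaU_of_ne _ _ _ (show (i, k).2 ≠ j from hk),
          map_X]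
    · simp only [RingHom.comp_apply, theta_X_inr, map_C, piB_xB]

/-- Naturality of `Θ_j` in `I`, pointwise. [folklore] -/
theorem theta_eq_map_piB_theta (P : RUX r m) : theta Q r j P = MvPolynomial.map (piB h j) (theta I r j P) := by
  rw [← map_piB_comp_theta h r j]
  rfl

end Functorial

/-- An element of `B_j(⋂_{Q ∈ t} Q)` vanishing in every `B_j(Q)` is zero. [folklore] -/
theorem eq_zero_of_forall_piB_eq_zero {t : Finset (Ideal (Rx m))} {j : Fin (m + 1)}
    {b : Bloc (t.inf id) j}
    (hb : ∀ (Q : Ideal (Rx m)) (hQ : Q ∈ t), piB (show t.inf id ≤ Q from Finset.inf_le hQ) j b = 0) :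
    b = 0 := by
  classical
  obtain ⟨⟨a, s⟩, rfl⟩ := IsLocalization.mk'_surjective (Submonoid.powers (xq (t.inf id) j)) b
  obtain ⟨p, rfl⟩ := Ideal.Quotient.mk_surjective a
  -- in each `B_j(Q)`: `x_j^{n_Q} p ∈ Q`
  have hQ : ∀ Q ∈ t, ∃ n : ℕ, (X j : Rx m) ^ n * p ∈ Q := by
    intro Q hQ
    have h0 := hb Q hQ
    simp only [piB, IsLocalization.map_mk', IsLocalization.mk'_eq_zero_iff] at h0
    obtain ⟨⟨_, n, rfl⟩, hn⟩ := h0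
    refine ⟨n, ?_⟩
    rw [← Ideal.Quotient.eq_zero_iff_mem, map_mul, map_pow]
    have hn' : xq Q j ^ n * Ideal.Quotient.mk Q p = 0 := by
      rw [← Ideal.Quotient.factor_mk (show t.inf id ≤ Q from Finset.inf_le hQ) p]
      exact hn
    exact hn'
  choose! n hn using hQ
  set N := t.sup n with hN
  have hmem : (X j : Rx m) ^ N * p ∈ t.inf id := by
    refine Submodule.mem_finsetInf.2 fun Q hQ => ?_
    have hle : n Q ≤ N := Finset.le_sup (f := n) hQ
    have e : (X j : Rx m) ^ N * p = X j ^ (N - n Q) * (X j ^ n Q * p) := by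
      rw [← mul_assoc, ← pow_add, Nat.sub_add_cancel hle]
    rw [e]
    exact Ideal.mul_mem_left _ _ (hn Q hQ)
  rw [IsLocalization.mk'_eq_zero_iff]
  refine ⟨⟨xq (t.inf id) j ^ N, N, rfl⟩, ?_⟩
  change xq (t.inf id) j ^ N * Ideal.Quotient.mk _ p = 0
  rw [← map_pow, ← map_mul, Ideal.Quotient.eq_zero_iff_mem]
  exact hmem

/-- `Θ_j` over `⋂ Q` vanishes on `P` as soon as every `Θ_j^Q` does. [folklore] -/
theorem theta_finset_inf_eq_zero {t : Finset (Ideal (Rx m))} {r : ℕ} {j : Fin (m + 1)} {P : RUX r m}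
    (h : ∀ Q ∈ t, theta Q r j P = 0) : theta (t.inf id) r j P = 0 := by
  ext d
  rw [coeff_zero]
  refine eq_zero_of_forall_piB_eq_zero fun Q hQ => ?_
  have hle : t.inf id ≤ Q := Finset.inf_le hQ
  have := congrArg (coeff d) (theta_eq_map_piB_theta hle r j P)
  rw [h Q hQ, coeff_zero, coeff_map] at this
  exact this.symm

/-- **Philippon's Proposition 1.3 (iv)** (for `d = (1, …, 1)`, `R = ℚ`): the `U`-eliminant ideal of a
finite intersection is the intersection of the `U`-eliminant ideals, `(⋂ Q)‾(r) = ⋂ Q̄(r)`.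
[cite: Philippon1986Criteres, Prop. 1.3 (iv) (pp. 10–11)] -/
theorem elimIdeal_finset_inf (t : Finset (Ideal (Rx m))) (r : ℕ) :
    elimIdeal (t.inf id) r = ⨅ Q ∈ t, elimIdeal Q r := by
  apply le_antisymm
  · refine le_iInf₂ fun Q hQ G hG => ?_
    rw [mem_elimIdeal_iff_theta] at hG ⊢
    intro j
    have hle : t.inf id ≤ Q := Finset.inf_le hQ
    rw [theta_eq_map_piB_theta hle r j, hG j, map_zero]
  · intro G hG
    rw [mem_elimIdeal_iff_theta]
    intro j
    refine theta_finset_inf_eq_zero fun Q hQ => ?_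
    have hGQ : G ∈ elimIdeal Q r := by
      have h1 := (Submodule.mem_iInf _).1 hG Q
      exact (Submodule.mem_iInf _).1 h1 hQ
    exact (mem_elimIdeal_iff_theta Q r G).1 hGQ j

/-- Prop. 1.3 (iv) for a (minimal) primary decomposition `I = ⋂_{Q ∈ t} Q`.
[cite: Philippon1986Criteres, Prop. 1.3 (iv) (pp. 10–11)] -/
theorem elimIdeal_eq_iInf_of_isMinimalPrimaryDecomposition {I : Ideal (Rx m)} {t : Finset (Ideal (Rx m))}
    (ht : Submodule.IsMinimalPrimaryDecomposition I t) (r : ℕ) :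
    elimIdeal I r = ⨅ Q ∈ t, elimIdeal Q r := by
  rw [← elimIdeal_finset_inf, ht.inf_eq]

/-! ### Prime ideals: the generic-point description of `𝔭̄(r)` and Proposition 1.3 (ii) -/

section Prime

variable (𝔭 : Ideal (Rx m)) [𝔭.IsPrime] (r : ℕ)

/-- `Ω = Frac(ℚ[x̲]/𝔭)`, the field of rational functions on `V(𝔭)`. [folklore] -/
abbrev Ω : Type := FractionRing (Rx m ⧸ 𝔭)

/-- The generic point: `ξ_k = x̄_k ∈ Ω`. [folklore] -/
abbrev ξ (k : Fin (m + 1)) : Ω 𝔭 := algebraMap (Rx m ⧸ 𝔭) (Ω 𝔭) (xq 𝔭 k)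

/-- `ℚ → Ω`. [folklore] -/
def qΩ : ℚ →+* Ω 𝔭 := (algebraMap (Rx m ⧸ 𝔭) (Ω 𝔭)).comp ((Ideal.Quotient.mk 𝔭).comp C)

omit [𝔭.IsPrime] in
variable {𝔭} in
/-- `ξ_j ≠ 0` when `x_j ∉ 𝔭`. [folklore] -/
theorem ξ_ne_zero {j : Fin (m + 1)} (hj : (X j : Rx m) ∉ 𝔭) : ξ 𝔭 j ≠ 0 := by
  rw [Ne, IsFractionRing.to_map_eq_zero_iff, Ideal.Quotient.eq_zero_iff_mem]
  exact hj

/-- The substitution `τ_j` on `Ω[U]`: `u_{ij} ↦ -(1/ξ_j) ∑_{k ≠ j} ξ_k u_{ik}` ("the hyperplanes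
`L₁, …, L_r` pass through the generic point `ξ`"). [cite: HodgePedoe1994, vol. II, Ch. X §6, eq. (1)] -/
def tauU (j : Fin (m + 1)) (ik : Fin r × Fin (m + 1)) : MvPolynomial (Fin r × Fin (m + 1)) (Ω 𝔭) :=
  if ik.2 = j then -(C (ξ 𝔭 j)⁻¹ * ∑ k ∈ Finset.univ.erase j, C (ξ 𝔭 k) * X (ik.1, k)) else X ik

/-- `τ_j : Ω[U] → Ω[U]`. [folklore] -/
def tau (j : Fin (m + 1)) :
    MvPolynomial (Fin r × Fin (m + 1)) (Ω 𝔭) →+* MvPolynomial (Fin r × Fin (m + 1)) (Ω 𝔭) :=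
  eval₂Hom C (tauU 𝔭 r j)

/-- **The generic-point map** `Φ_j : ℚ[U] → Ω[U]`, `G ↦ G(hyperplanes through ξ)`.
[cite: HodgePedoe1994, vol. II, Ch. X §6] -/
def Phi (j : Fin (m + 1)) : RU r m →+* MvPolynomial (Fin r × Fin (m + 1)) (Ω 𝔭) :=
  (tau 𝔭 r j).comp (MvPolynomial.map (qΩ 𝔭))

/-- `τ_j` fixes constants. [folklore] -/
@[simp] theorem tau_C (j : Fin (m + 1)) (c : Ω 𝔭) : tau 𝔭 r j (C c) = C c := by simp [tau]

/-- `τ_j` on variables. [folklore] -/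
@[simp] theorem tau_X (j : Fin (m + 1)) (ik : Fin r × Fin (m + 1)) : tau 𝔭 r j (X ik) = tauU 𝔭 r j ik := by
  simp [tau]

/-- `τ_j(u_{ik}) = u_{ik}` for `k ≠ j`. [folklore] -/
theorem tauU_of_ne {j : Fin (m + 1)} {ik : Fin r × Fin (m + 1)} (h : ik.2 ≠ j) : tauU 𝔭 r j ik = X ik := by
  simp [tauU, h]

/-- `τ_j(u_{ij}) = -(1/ξ_j) ∑_{k ≠ j} ξ_k u_{ik}`. [folklore] -/
theorem tauU_self (j : Fin (m + 1)) (i : Fin r) :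
    tauU 𝔭 r j (i, j) = -(C (ξ 𝔭 j)⁻¹ * ∑ k ∈ Finset.univ.erase j, C (ξ 𝔭 k) * X (i, k)) := by
  simp [tauU]

variable {𝔭}

/-- `B_j = (ℚ[x̲]/𝔭)[1/x̄_j] → Ω` (for `x_j ∉ 𝔭`). [folklore] -/
def iotaB {j : Fin (m + 1)} (hj : (X j : Rx m) ∉ 𝔭) : Bloc 𝔭 j →+* Ω 𝔭 :=
  IsLocalization.Away.lift (xq 𝔭 j) (g := algebraMap (Rx m ⧸ 𝔭) (Ω 𝔭))
    (isUnit_iff_ne_zero.2 (ξ_ne_zero hj))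

/-- `B_j → Ω` extends `ℚ[x̲]/𝔭 → Ω`. [folklore] -/
theorem iotaB_algebraMap {j : Fin (m + 1)} (hj : (X j : Rx m) ∉ 𝔭) (a : Rx m ⧸ 𝔭) :
    iotaB hj (algebraMap _ (Bloc 𝔭 j) a) = algebraMap _ (Ω 𝔭) a :=
  IsLocalization.Away.lift_eq _ _ _

/-- `B_j → Ω` maps `x̄_k` to `ξ_k`. [folklore] -/
theorem iotaB_xB {j : Fin (m + 1)} (hj : (X j : Rx m) ∉ 𝔭) (k : Fin (m + 1)) :
    iotaB hj (xB 𝔭 j k) = ξ 𝔭 k :=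
  iotaB_algebraMap hj _

/-- `B_j → Ω` maps `1/x̄_j` to `ξ_j⁻¹`. [folklore] -/
theorem iotaB_invSelf {j : Fin (m + 1)} (hj : (X j : Rx m) ∉ 𝔭) :
    iotaB hj (IsLocalization.Away.invSelf (xq 𝔭 j)) = (ξ 𝔭 j)⁻¹ := by
  refine eq_inv_of_mul_eq_one_left ?_
  rw [← iotaB_xB hj j, ← map_mul, mul_comm, IsLocalization.Away.mul_invSelf, map_one]

/-- `B_j → Ω` is injective. [folklore] -/
theorem iotaB_injective {j : Fin (m + 1)} (hj : (X j : Rx m) ∉ 𝔭) : Function.Injective (iotaB hj) := by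
  rw [injective_iff_map_eq_zero]
  intro b hb
  obtain ⟨⟨a, s⟩, rfl⟩ := IsLocalization.mk'_surjective (Submonoid.powers (xq 𝔭 j)) b
  have hspec := IsLocalization.mk'_spec (Bloc 𝔭 j) a s
  have h1 := congrArg (iotaB hj) hspec
  rw [map_mul, iotaB_algebraMap, iotaB_algebraMap] at h1
  change iotaB hj (IsLocalization.mk' (Bloc 𝔭 j) a s) = 0 at hb
  rw [hb, zero_mul] at h1
  have ha : a = 0 := (IsFractionRing.injective (Rx m ⧸ 𝔭) (Ω 𝔭)) (by rw [map_zero]; exact h1.symm)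
  simp [ha]

/-- `Φ_j = (B_j[U] → Ω[U]) ∘ Θ_j` on `ℚ[U]`. [folklore] -/
theorem map_iotaB_comp_theta {j : Fin (m + 1)} (hj : (X j : Rx m) ∉ 𝔭) :
    (MvPolynomial.map (iotaB hj)).comp ((theta 𝔭 r j).comp (rename Sum.inl).toRingHom) = Phi 𝔭 r j := by
  apply MvPolynomial.ringHom_ext
  · intro c
    simp only [RingHom.comp_apply, AlgHom.toRingHom_eq_coe, RingHom.coe_coe, rename_C, theta_C, map_C,
      cB, iotaB_algebraMap, Phi, tau_C, qΩ]
  · rintro ⟨i, k⟩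
    by_cases hk : k = j
    · subst hk
      simp only [RingHom.comp_apply, AlgHom.toRingHom_eq_coe, RingHom.coe_coe, rename_X, theta_X_inl,
        thetaU_self, map_neg, map_mul, map_sum, map_C, map_X, iotaB_xB, iotaB_invSelf, Phi, tau_X,
        tauU_self]
    · simp only [RingHom.comp_apply, AlgHom.toRingHom_eq_coe, RingHom.coe_coe, rename_X, theta_X_inl,
        thetaU_of_ne _ _ _ (show (i, k).2 ≠ j from hk), map_X, Phi, tau_X,
        tauU_of_ne _ _ (show (i, k).2 ≠ j from hk)]

/-- For `x_j ∉ 𝔭`: `Θ_j(G) = 0 ⇔ Φ_j(G) = 0`. [folklore] -/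
theorem theta_rename_eq_zero_iff_Phi {j : Fin (m + 1)} (hj : (X j : Rx m) ∉ 𝔭) (G : RU r m) :
    theta 𝔭 r j (rename Sum.inl G) = 0 ↔ Phi 𝔭 r j G = 0 := by
  rw [← map_iotaB_comp_theta r hj]
  change _ ↔ MvPolynomial.map (iotaB hj) (theta 𝔭 r j (rename Sum.inl G)) = 0
  rw [← (MvPolynomial.map (iotaB hj)).map_zero]
  exact ((MvPolynomial.map_injective _ (iotaB_injective hj)).eq_iff).symm

variable (𝔭)

/-- `τ_j ∘ τ_{j'} = τ_j` (both send every `Lᵢ` to `0` and are the identity modulo `(L₁, …, L_r)`).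
[folklore] -/
theorem tau_comp_tau {j j' : Fin (m + 1)} (hj : (X j : Rx m) ∉ 𝔭) (hj' : (X j' : Rx m) ∉ 𝔭) :
    (tau 𝔭 r j).comp (tau 𝔭 r j') = tau 𝔭 r j := by
  apply MvPolynomial.ringHom_ext
  · intro c
    simp
  · rintro ⟨i, k⟩
    simp only [RingHom.comp_apply, tau_X]
    by_cases hk : k = j'
    · subst hk
      by_cases hjj : j = k
      · subst hjj
        rw [tauU_self, map_neg, map_mul, tau_C, map_sum]
        congr 2
        refine Finset.sum_congr rfl fun k' hk' => ?_
        rw [map_mul, tau_C, tau_X, tauU_of_ne _ _ (by simpa using Finset.ne_of_mem_erase hk')]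
      · -- `j ≠ k = j'`
        have hjmem : j ∈ Finset.univ.erase k := Finset.mem_erase.2 ⟨hjj, Finset.mem_univ j⟩
        have hkmem : k ∈ Finset.univ.erase j := Finset.mem_erase.2 ⟨Ne.symm hjj, Finset.mem_univ k⟩
        rw [tauU_of_ne _ _ (show (i, k).2 ≠ j from Ne.symm hjj), tauU_self, map_neg, map_mul, tau_C,
          map_sum]
        have hS : ∑ x ∈ Finset.univ.erase k, tau 𝔭 r j (C (ξ 𝔭 x) * X (i, x)) =
            C (ξ 𝔭 j) * tauU 𝔭 r j (i, j) +
              ∑ x ∈ (Finset.univ.erase k).erase j, C (ξ 𝔭 x) * X (i, x) := by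
          rw [← Finset.add_sum_erase _ _ hjmem, map_mul, tau_C, tau_X]
          congr 1
          refine Finset.sum_congr rfl fun k' hk' => ?_
          rw [map_mul, tau_C, tau_X, tauU_of_ne _ _ (by simpa using Finset.ne_of_mem_erase hk')]
        have hT : ∑ x ∈ Finset.univ.erase j, C (ξ 𝔭 x) * X (i, x) =
            C (ξ 𝔭 k) * X (i, k) + ∑ x ∈ (Finset.univ.erase k).erase j, C (ξ 𝔭 x) * X (i, x) := by
          rw [← Finset.add_sum_erase _ _ hkmem, Finset.erase_right_comm]
        rw [hS, tauU_self, hT]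
        set T := ∑ x ∈ (Finset.univ.erase k).erase j, C (ξ 𝔭 x) * X (i, x)
        have hξj : (C (ξ 𝔭 j) : MvPolynomial (Fin r × Fin (m + 1)) (Ω 𝔭)) * C (ξ 𝔭 j)⁻¹ = 1 := by
          rw [← map_mul, mul_inv_cancel₀ (ξ_ne_zero hj), map_one]
        have hξk' : (C (ξ 𝔭 k)⁻¹ : MvPolynomial (Fin r × Fin (m + 1)) (Ω 𝔭)) * C (ξ 𝔭 k) = 1 := by
          rw [← map_mul, inv_mul_cancel₀ (ξ_ne_zero hj'), map_one]
        linear_combination (C (ξ 𝔭 k)⁻¹ * (C (ξ 𝔭 k) * X (i, k) + T)) * hξj + X (i, k) * hξk'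
    · rw [tauU_of_ne _ _ (show (i, k).2 ≠ j' from hk), tau_X]

/-- The conditions `Φ_j(G) = 0` for the various `j` with `x_j ∉ 𝔭` are all equivalent. [folklore] -/
theorem Phi_eq_zero_iff_of_notMem {j j' : Fin (m + 1)} (hj : (X j : Rx m) ∉ 𝔭) (hj' : (X j' : Rx m) ∉ 𝔭)
    (G : RU r m) : Phi 𝔭 r j G = 0 ↔ Phi 𝔭 r j' G = 0 := by
  constructor <;> intro h
  · change tau 𝔭 r j' (MvPolynomial.map (qΩ 𝔭) G) = 0
    rw [← tau_comp_tau 𝔭 r hj' hj, RingHom.comp_apply]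
    change tau 𝔭 r j' (Phi 𝔭 r j G) = 0
    rw [h, map_zero]
  · change tau 𝔭 r j (MvPolynomial.map (qΩ 𝔭) G) = 0
    rw [← tau_comp_tau 𝔭 r hj hj', RingHom.comp_apply]
    change tau 𝔭 r j (Phi 𝔭 r j' G) = 0
    rw [h, map_zero]

omit [𝔭.IsPrime] in
/-- For `x_j ∈ 𝔭` the ring `B_j` is trivial, so `Θ_j` vanishes identically. [folklore] -/
theorem theta_eq_zero_of_mem {j : Fin (m + 1)} (hj : (X j : Rx m) ∈ 𝔭) (P : RUX r m) : theta 𝔭 r j P = 0 := by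
  have h0 : (0 : Rx m ⧸ 𝔭) ∈ Submonoid.powers (xq 𝔭 j) :=
    ⟨1, by simpa using Ideal.Quotient.eq_zero_iff_mem.2 hj⟩
  haveI : Subsingleton (Bloc 𝔭 j) := IsLocalization.subsingleton h0
  ext d
  exact Subsingleton.elim _ _

/-- **The generic-point description of `𝔭̄(r)`**: for a prime `𝔭` and any `j₀` with `x_{j₀} ∉ 𝔭`,
`G ∈ 𝔭̄(r)` iff `G` vanishes on the generic `r`-tuple of hyperplanes through the generic point `ξ`
of `V(𝔭)`, i.e. `Φ_{j₀}(G) = 0` in `Ω[U]`.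
[cite: Philippon1986Criteres, Lemme 1.2 and Prop. 1.3 (ii) (p. 10); HodgePedoe1994, vol. II, Ch. X §6] -/
theorem mem_elimIdeal_iff_Phi {j₀ : Fin (m + 1)} (hj₀ : (X j₀ : Rx m) ∉ 𝔭) (G : RU r m) :
    G ∈ elimIdeal 𝔭 r ↔ Phi 𝔭 r j₀ G = 0 := by
  rw [mem_elimIdeal_iff_theta]
  constructor
  · intro h
    exact (theta_rename_eq_zero_iff_Phi r hj₀ G).1 (h j₀)
  · intro h j
    by_cases hj : (X j : Rx m) ∈ 𝔭
    · exact theta_eq_zero_of_mem 𝔭 r hj _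
    · rw [theta_rename_eq_zero_iff_Phi r hj, Phi_eq_zero_iff_of_notMem 𝔭 r hj hj₀]
      exact h

/-- `𝔭̄(r) = ker Φ_{j₀}`. [cite: Philippon1986Criteres, Prop. 1.3 (ii) (p. 10)] -/
theorem elimIdeal_eq_ker_Phi {j₀ : Fin (m + 1)} (hj₀ : (X j₀ : Rx m) ∉ 𝔭) :
    elimIdeal 𝔭 r = RingHom.ker (Phi 𝔭 r j₀) := by
  ext G
  rw [RingHom.mem_ker, mem_elimIdeal_iff_Phi 𝔭 r hj₀]

variable {𝔭 r}

omit [𝔭.IsPrime] in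
/-- A prime (indeed any ideal) not containing the irrelevant ideal misses some variable. [folklore] -/
theorem exists_X_notMem (hirr : ¬ Ideal.span (Set.range (X : Fin (m + 1) → Rx m)) ≤ 𝔭) :
    ∃ j : Fin (m + 1), (X j : Rx m) ∉ 𝔭 := by
  by_contra h
  push Not at h
  apply hirr
  rw [Ideal.span_le]
  rintro _ ⟨j, rfl⟩
  exact h j

variable (𝔭 r)

/-- **Philippon's Proposition 1.3 (ii)** (for `d = (1, …, 1)`, `R = ℚ`): for a prime ideal `𝔭` not
containing `(x₀, …, x_m)`, the `U`-eliminant ideal `𝔭̄(r)` is prime.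
[cite: Philippon1986Criteres, Prop. 1.3 (ii) (p. 10)] -/
theorem isPrime_elimIdeal (hirr : ¬ Ideal.span (Set.range (X : Fin (m + 1) → Rx m)) ≤ 𝔭) :
    (elimIdeal 𝔭 r).IsPrime := by
  obtain ⟨j₀, hj₀⟩ := exists_X_notMem hirr
  rw [elimIdeal_eq_ker_Phi 𝔭 r hj₀]
  exact RingHom.ker_isPrime _

end Prime

end Nesterenko

end Literature.NumberTheory.Transcendental

end
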